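import Summits.ResolutionOfSingularities.ResolutionOfSingularities.Theorems.PurelyInseparableDim4JointWaitingKid
import HarnessLib

/-!
# Purely inseparable four-folds: the WAITING KID at a host whose chart SEES the waiting member — the deeper-host form of part 35
# (brick S3 (c) «joint point∘coordinate chains», part 44 = v3 (a1) geometric half beyond the root; cell `res-dim4-pi`)

[OURS · counted 0] (D-0157 DOOR 2; desk WORD #66 (4)(c), #74 (g), #99 (d); frame `PIDim4.TerminationImpliesOrderReduction`, S3 (c)
v3, memo `S3c-V3-DESIGN.md` Addendum 4 (CAUTION) and `S3c-V3LITE-LANDED.md` successor item 4; host item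
stmt-ResolutionOfSingularities-16155, helper). Nothing here proves resolution of singularities in dimension ≥ 4 / characteristic `p` —
NOT here, not anywhere in this programme.

Part 35's `waiting_kid_package_of_iso` asks the host to be ROOT-TYPE (`ψ` onto, `φ(Y)` closed, empty boundary). For waiting members
hosted DEEPER in the forest the three hypotheses are replaced by what they were used for: with `W_T := {x : x_i − c_i ∈ 𝔭_x (i ∈ T)}`
the translated linear subspace of `𝔸⁵` carrying the waiting member in host coordinates,
(1) the host chart SEES it: `W_T ⊆ ψ(Y)`; (2) its image `φ(ψ⁻¹ W_T)` is CLOSED in `Z`; (3) every OLD boundary component of `M` MISSES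
`φ(ψ⁻¹ W_T)` (so only the new exceptional component meets the kid, with translated shape `(j, 0)`).

* **`waiting_kid_package_of_sees`** — same conclusion as part 35 (closed kid, re-centring `Θ`, model description through `ε`,
  projection into `φ(ψ⁻¹ W_T)`, non-empty, regular, snc with `(M.transform π Zc).boundary`, zigzag chart reading the kid state and
  `𝓘Λ T`, ranges, translated shape, injectivity). Part 35 is the case `ψ` onto, `φ(Y)` closed, `M.boundary = []`.

What is NOT here: the node theorem threading waiting members to deeper hosts (successor). AI-produced formalisation, weaker than expert
review. bears_on: LADDER-RESOLUTION:D157-DOOR2 (res-dim4-pi · S3 (c) joint v3 · deeper hosts).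
-/

set_option linter.dupNamespace false -- D-0017: single-problem summit path `Summit.<S>.<S>.…` by design

noncomputable section

open MvPolynomial Finset CategoryTheory AlgebraicGeometry Opposite TopologicalSpace
open AlgebraicGeometry.Scheme.IdealSheafData (ofIdealTop vanishingIdeal)

namespace Summit.ResolutionOfSingularities.ResolutionOfSingularities.Theorems.PIDim4

open Literature.AlgebraicGeometry.Resolution
open Literature.AlgebraicGeometry.Resolution.Hauser2010
open Literature.AlgebraicGeometry.Resolution.AffinePointBlowup (P A γ coord Wtop ξ)

namespace Equimultiple

/-! ## The waiting kid at a host that sees the waiting member -/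

section WaitingKidSees

variable {K : Type} [Field K] {p : ℕ} [hp : Fact p.Prime] [CharP K p] [DecidableEq K]
variable {Z Y W Bl : Scheme.{0}} (φ : Y ⟶ Z) [IsOpenImmersion φ] (ψ : Y ⟶ P 4 K) [IsOpenImmersion ψ]
  {π : W ⟶ Z} {B : Bl ⟶ P 4 K} {S : Finset (Fin 4)}
  (ε : (π ⁻¹ᵁ φ.opensRange : Scheme.{0}) ≅ (B ⁻¹ᵁ ψ.opensRange : Scheme.{0}))

/-- **THE WAITING KID AT A HOST THAT SEES THE WAITING MEMBER** (through the shared `ε`). As part 35's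
`waiting_kid_package_of_iso`, with the root-type hypotheses replaced by: `W_T = {x | x_i − c_i ∈ 𝔭_x (i ∈ T)} ⊆ ψ(Y)` (`hWsee`),
`φ(ψ⁻¹ W_T)` closed in `Z` (`hWc`), and every old boundary component of `M` disjoint from `φ(ψ⁻¹ W_T)` (`hbdW`).
[cite: BierstoneGrigorievMilmanWlodarczyk2011, Def. 3.1.3 (1)–(2), (4)] [cite: GortzWedhorn2020, Prop. 13.91]
[cite: Hauser2010, §G (transversal strict transforms in the chart expression)] -/
theorem waiting_kid_package_of_sees [IsLocallyNoetherian Z] [IsAlgClosed K] (Zc : Z.IdealSheafData)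
    (hπ : IsBlowup π Zc) (hB : IsBlowup B (AffineCoordBlowup.𝓘Λ 4 K (insert 0 (Fin.succ '' (S : Set (Fin 4))))))
    (hsq : ε.hom ≫ (B ∣_ ψ.opensRange) = (π ∣_ φ.opensRange) ≫ (φ.isoOpensRange.inv ≫ ψ.isoOpensRange.hom))
    (hC' : ((AffineCoordBlowup.𝓘Λ 4 K (insert 0 (Fin.succ '' (S : Set (Fin 4))))).comap ψ.opensRange.ι).comap
        (φ.isoOpensRange.inv ≫ ψ.isoOpensRange.hom) = Zc.comap φ.opensRange.ι)
    (M : MarkedIdeal Z) (hmult : M.mult = p) (s : State K)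
    (hKEY : ((controlledTransform B (AffineCoordBlowup.𝓘Λ 4 K (insert 0 (Fin.succ '' (S : Set (Fin 4)))))
        (hypSheaf p s.F) p).comap (B ⁻¹ᵁ ψ.opensRange).ι).comap ε.hom =
      (controlledTransform π Zc M.ideal p).comap (π ⁻¹ᵁ φ.opensRange).ι)
    (hperm : (p : ℕ∞) ≤ CentreBlowup.ordAlong S s.F)
    (hsee : (AffineCoordBlowup.CΛ 4 K (insert 0 (Fin.succ '' (S : Set (Fin 4)))) : Set (P 4 K)) ⊆ Set.range ψ)
    (hT : IsClosed (φ '' (ψ ⁻¹' (AffineCoordBlowup.CΛ 4 K (insert 0 (Fin.succ '' (S : Set (Fin 4)))) : Set (P 4 K)))))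
    (hsncZ : HasSNCWith M.boundary Zc)
    {j : Fin 4} (hj : j ∈ S) {c : Fin 4 → K} (hcj : c j = 0) (hcS : ∀ i ∈ S, c i = 0)
    {T : Finset (Fin 4)} (hsub : S.erase j ⊆ T) (hjT : j ∉ T)
    (hWsee : {x : P 4 K | ∀ i ∈ T, (X i.succ - C (c i) : A 4 K) ∈ x.asIdeal} ⊆ Set.range ψ)
    (hWc : IsClosed (φ '' (ψ ⁻¹' {x : P 4 K | ∀ i ∈ T, (X i.succ - C (c i) : A 4 K) ∈ x.asIdeal})))
    (hbdW : ∀ D ∈ M.boundary, Disjoint (D.support : Set Z)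
      (φ '' (ψ ⁻¹' {x : P 4 K | ∀ i ∈ T, (X i.succ - C (c i) : A 4 K) ∈ x.asIdeal}))) :
    ∃ (c'' : Closeds W) (Θ : A 4 K ≃ₐ[K] A 4 K),
      (∀ i : Fin 4, Θ (X i.succ) = X i.succ + C (c i)) ∧
      (controlledTransform B (AffineCoordBlowup.𝓘Λ 4 K (insert 0 (Fin.succ '' (S : Set (Fin 4))))) (hypSheaf p s.F) p).comap
          (Spec.map (CommRingCat.ofHom (Θ : A 4 K →+* A 4 K)) ≫
            AffineCoordBlowup.chartImm hB (ChartDictionary.succ_mem_centreVars hj)) =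
        hypSheaf p (CentreBlowup.step p S j c s).F ∧
      (∀ (w : W) (hwV : w ∈ π ⁻¹ᵁ φ.opensRange), w ∈ (c'' : Set W) ↔
        ((B ⁻¹ᵁ ψ.opensRange).ι (ε.hom ⟨w, hwV⟩) : Bl) ∈
          (Spec.map (CommRingCat.ofHom (Θ : A 4 K →+* A 4 K)) ≫
            AffineCoordBlowup.chartImm hB (ChartDictionary.succ_mem_centreVars hj)) ''
            (AffineCoordBlowup.CΛ 4 K (insert 0 (Fin.succ '' (T : Set (Fin 4)))) : Set (P 4 K))) ∧
      (∀ w ∈ (c'' : Set W), π w ∈ φ '' (ψ ⁻¹' {x : P 4 K | ∀ i ∈ T, (X i.succ - C (c i) : A 4 K) ∈ x.asIdeal})) ∧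
      (c'' : Set W).Nonempty ∧
      Scheme.IsRegular (vanishingIdeal c'').subscheme ∧
      HasSNCWith (M.transform π Zc).boundary (vanishingIdeal c'') ∧
      ∃ (Y'' : Scheme.{0}) (φ'' : Y'' ⟶ W) (ψ'' : Y'' ⟶ P 4 K) (_ : IsOpenImmersion φ'') (_ : IsOpenImmersion ψ''),
        (M.transform π Zc).ideal.comap φ'' = (hypSheaf p (CentreBlowup.step p S j c s).F).comap ψ'' ∧
        (vanishingIdeal c'').comap φ'' =
          (AffineCoordBlowup.𝓘Λ 4 K (insert 0 (Fin.succ '' (T : Set (Fin 4))))).comap ψ'' ∧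
        (c'' : Set W) ⊆ Set.range φ'' ∧
        (AffineCoordBlowup.CΛ 4 K (insert 0 (Fin.succ '' (T : Set (Fin 4)))) : Set (P 4 K)) ⊆ Set.range ψ'' ∧
        ∃ (idx₂ : W.IdealSheafData → Fin 4) (cst₂ : W.IdealSheafData → K),
          (∀ D₂ ∈ (M.transform π Zc).boundary,
            ((D₂.support : Set W) ∩ φ'' '' (ψ'' ⁻¹'
              (AffineCoordBlowup.CΛ 4 K (insert 0 (Fin.succ '' (T : Set (Fin 4)))) : Set (P 4 K)))).Nonempty →
            D₂.comap φ'' = (ofIdealTop (Ideal.span {(γ 4 K).symm (X (idx₂ D₂).succ + C (cst₂ D₂))})).comap ψ'' ∧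
              (idx₂ D₂ ∈ T → cst₂ D₂ = 0)) ∧
          (∀ D₁ ∈ (M.transform π Zc).boundary, ∀ D₂ ∈ (M.transform π Zc).boundary,
            ((D₁.support : Set W) ∩ φ'' '' (ψ'' ⁻¹'
              (AffineCoordBlowup.CΛ 4 K (insert 0 (Fin.succ '' (T : Set (Fin 4)))) : Set (P 4 K)))).Nonempty →
            ((D₂.support : Set W) ∩ φ'' '' (ψ'' ⁻¹'
              (AffineCoordBlowup.CΛ 4 K (insert 0 (Fin.succ '' (T : Set (Fin 4)))) : Set (P 4 K)))).Nonempty →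
            idx₂ D₁ = idx₂ D₂ → D₁ = D₂) := by
  haveI : PerfectRing K p := PerfectRing.ofSurjective K p fun x => IsAlgClosed.exists_pow_nat_eq x hp.out.pos
  haveI : IsProper π := hπ.isProper
  haveI : IsLocallyNoetherian W := LocallyOfFiniteType.isLocallyNoetherian π
  haveI : IsProper B := hB.isProper
  haveI : IsLocallyNoetherian Bl := LocallyOfFiniteType.isLocallyNoetherian B
  have hK := hKEY
  obtain ⟨Θ, h, h0, hs, hc⟩ := ChartDictionary.controlledTransform_chart_eq_step p hj hcj s hperm hB
  haveI := isOpenImmersion_specMap_algEquiv Θ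
  have hsR : ∀ k : Fin 4, (Θ : A 4 K →+* A 4 K) (X k.succ) = X k.succ + C (c k) := fun k => hs k
  have hCR : ∀ r : K, (Θ : A 4 K →+* A 4 K) (C r) = C r := fun r => Θ.commutes r
  obtain ⟨hread, hexc, -⟩ :=
    ChartDictionary.zigzag_chart_of_chart φ ψ M hmult s.F (CentreBlowup.step p S j c s).F Zc hsee hT hB ε hsq hC' hK
      hj hcj h0 hs hc
  set φ₀ : P 4 K ⟶ Bl := Spec.map (CommRingCat.ofHom (Θ : A 4 K →+* A 4 K)) ≫
    AffineCoordBlowup.chartImm hB (ChartDictionary.succ_mem_centreVars hj) with hφ₀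
  set φ'' := (φ₀ ∣_ (B ⁻¹ᵁ ψ.opensRange)) ≫ ε.inv ≫ (π ⁻¹ᵁ φ.opensRange).ι with hφ''
  set ψ'' := (φ₀ ⁻¹ᵁ (B ⁻¹ᵁ ψ.opensRange)).ι with hψ''
  haveI : IsOpenImmersion φ₀ := by rw [hφ₀]; infer_instance
  haveI : IsOpenImmersion φ'' := by rw [hφ'']; infer_instance
  -- the model chart maps the next centre into `W_T`, which the host chart sees
  have hTD : ∀ y ∈ (AffineCoordBlowup.CΛ 4 K (insert 0 (Fin.succ '' (T : Set (Fin 4)))) : Set (P 4 K)),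
      B (φ₀ y) ∈ {x : P 4 K | ∀ i ∈ T, (X i.succ - C (c i) : A 4 K) ∈ x.asIdeal} := fun y hy i hi =>
    X_sub_C_mem_B_chart_apply_of_mem_CΛ hB hj hjT hcj hcS hCR hsR hy hi
  have hsee'' : (AffineCoordBlowup.CΛ 4 K (insert 0 (Fin.succ '' (T : Set (Fin 4)))) : Set (P 4 K)) ⊆ Set.range ψ'' :=
    ChartDictionary.zigzag_transport_range ψ φ₀ _ fun y hy => hWsee (hTD y hy)
  -- closedness: typ-2's `erase` criterion on the model, transported over `D = W_T`
  have hclosed'' : IsClosed (φ'' '' (ψ'' ⁻¹'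
      (AffineCoordBlowup.CΛ 4 K (insert 0 (Fin.succ '' (T : Set (Fin 4)))) : Set (P 4 K)))) :=
    ChartDictionary.zigzag_transport_isClosed φ ψ ε φ₀ hsq _ _
      (ChartDictionary.isClosed_image_CΛ_chart hj hcj h0 hs hB hsub) hWc hTD
  set c'' : Closeds W := closureImage φ'' ((((AffineCoordBlowup.𝓘Λ 4 K
    (insert 0 (Fin.succ '' (T : Set (Fin 4))))).comap ψ'').support : Set (φ₀ ⁻¹ᵁ (B ⁻¹ᵁ ψ.opensRange)))) with hc''
  have hcoe : (c'' : Set W) = φ'' '' (ψ'' ⁻¹'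
      (AffineCoordBlowup.CΛ 4 K (insert 0 (Fin.succ '' (T : Set (Fin 4)))) : Set (P 4 K))) := by
    rw [hc'', coe_closureImage, ChartDictionary.coe_support_comap_𝓘Λ ψ'', hclosed''.closure_eq]
  -- the kid projects into `φ(ψ⁻¹ W_T)`; old boundary components miss it, the new one has translated shape `(j, 0)`
  have hproj : ∀ w ∈ φ'' '' (ψ'' ⁻¹' (AffineCoordBlowup.CΛ 4 K (insert 0 (Fin.succ '' (T : Set (Fin 4)))) : Set (P 4 K))),
      π w ∈ φ '' (ψ ⁻¹' {x : P 4 K | ∀ i ∈ T, (X i.succ - C (c i) : A 4 K) ∈ x.asIdeal}) := by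
    rintro _ ⟨y, hy, rfl⟩
    obtain ⟨hπy, hψy⟩ := ChartDictionary.zigzag_transport_π_apply φ ψ ε φ₀ hsq y
    rw [hπy]
    refine ⟨_, ?_, rfl⟩
    rw [Set.mem_preimage, hψy]
    exact hTD y.1 hy
  have hold : ∀ D ∈ M.boundary, ¬ (((strictTransformIdeal π Zc D).support : Set W) ∩ φ'' '' (ψ'' ⁻¹'
      (AffineCoordBlowup.CΛ 4 K (insert 0 (Fin.succ '' (T : Set (Fin 4)))) : Set (P 4 K)))).Nonempty := by
    rintro D hD ⟨w, hw1, hw2⟩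
    exact Set.disjoint_left.mp (hbdW D hD) (ChartDictionary.support_strictTransformIdeal_subset_preimage π _ D hw1) (hproj w hw2)
  have hnew : (Zc.comap π).comap φ'' = (ofIdealTop (Ideal.span {(γ 4 K).symm (X j.succ + C (0 : K))})).comap ψ'' := by
    rw [C_0, add_zero]
    exact hexc
  have hmemb : ∀ D₂ ∈ (M.transform π Zc).boundary,
      ((D₂.support : Set W) ∩ φ'' '' (ψ'' ⁻¹'
        (AffineCoordBlowup.CΛ 4 K (insert 0 (Fin.succ '' (T : Set (Fin 4)))) : Set (P 4 K)))).Nonempty → D₂ = Zc.comap π := by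
    intro D₂ hD₂ hm
    change D₂ ∈ M.boundary.map (strictTransformIdeal π Zc) ++ [Zc.comap π] at hD₂
    rw [List.mem_append, List.mem_map, List.mem_singleton] at hD₂
    rcases hD₂ with ⟨D, hD, rfl⟩ | h
    · exact absurd hm (hold D hD)
    · exact h
  have hshape₂ : ∀ D₂ ∈ (M.transform π Zc).boundary,
      ((D₂.support : Set W) ∩ φ'' '' (ψ'' ⁻¹'
        (AffineCoordBlowup.CΛ 4 K (insert 0 (Fin.succ '' (T : Set (Fin 4)))) : Set (P 4 K)))).Nonempty →
      D₂.comap φ'' = (ofIdealTop (Ideal.span {(γ 4 K).symm (X ((fun _ => j) D₂).succ + C ((fun _ => (0 : K)) D₂))})).comap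
          ψ'' ∧ ((fun _ => j) D₂ ∈ T → (fun _ => (0 : K)) D₂ = 0) := by
    intro D₂ hD₂ hm
    rw [hmemb D₂ hD₂ hm]
    exact ⟨hnew, fun _ => rfl⟩
  have hinj₂ : ∀ D₁ ∈ (M.transform π Zc).boundary, ∀ D₂ ∈ (M.transform π Zc).boundary,
      ((D₁.support : Set W) ∩ φ'' '' (ψ'' ⁻¹'
        (AffineCoordBlowup.CΛ 4 K (insert 0 (Fin.succ '' (T : Set (Fin 4)))) : Set (P 4 K)))).Nonempty →
      ((D₂.support : Set W) ∩ φ'' '' (ψ'' ⁻¹'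
        (AffineCoordBlowup.CΛ 4 K (insert 0 (Fin.succ '' (T : Set (Fin 4)))) : Set (P 4 K)))).Nonempty →
      (fun _ => j) D₁ = (fun _ => j) D₂ → D₁ = D₂ := by
    intro D₁ hD₁ D₂ hD₂ hm₁ hm₂ _
    rw [hmemb D₁ hD₁ hm₁, hmemb D₂ hD₂ hm₂]
  have hE₂ : HasSNC (M.transform π Zc).boundary := MarkedIdeal.hasSNC_transform_boundary M hsncZ hπ
  have hEc₂ : HasSNCWith ((M.transform π Zc).boundary.map (·.comap φ''))
      ((AffineCoordBlowup.𝓘Λ 4 K (insert 0 (Fin.succ '' (T : Set (Fin 4))))).comap ψ'') :=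
    ChartDictionary.hasSNCWith_comap_of_shapeT_zigzag φ'' ψ'' hE₂ (fun _ => j) (fun _ => (0 : K)) hshape₂ hinj₂
  -- non-emptiness: the origin of the chart lies on the kid
  have hξ : (ξ 4 K) ∈ AffineCoordBlowup.CΛ 4 K (insert 0 (Fin.succ '' (T : Set (Fin 4)))) := by
    rw [AffineCoordBlowup.mem_CΛ_iff']
    intro i _
    exact (mem_originIdeal_iff K (4 + 1)).mpr (constantCoeff_X K i)
  obtain ⟨y₀, hy₀⟩ := hsee'' hξ
  refine ⟨c'', Θ, hs, hc, fun w hwV => ?_, fun w hw => ?_, ⟨φ'' y₀, ?_⟩,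
    ChartDictionary.isRegular_globalCentre_zigzag φ'' ψ'' hclosed'',
    ChartDictionary.hasSNCWith_globalCentre_zigzag φ'' ψ'' hclosed'' hE₂ hEc₂, _, φ'', ψ'', inferInstance,
    inferInstance, hread, by rw [hc'']; exact ChartDictionary.comap_globalCentre_zigzag φ'' ψ'' _,
    by rw [hcoe]; exact Set.image_subset_range _ _, hsee'', fun _ => j, fun _ => 0, hshape₂, hinj₂⟩
  · -- model description of the points of the kid
    rw [hcoe]
    exact mem_image_zigzag_chart_iff φ ψ ε φ₀ _ hwV
  · -- projection: the kid lies over the translated subspace `{x_T = c_T}` seen through `(φ, ψ)`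
    rw [hcoe] at hw
    exact hproj w hw
  · -- non-emptiness
    rw [hcoe]
    exact ⟨y₀, by rw [Set.mem_preimage, hy₀]; exact hξ, rfl⟩

end WaitingKidSees

end Equimultiple

end Summit.ResolutionOfSingularities.ResolutionOfSingularities.Theorems.PIDim4

end
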